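import Literature.NumberTheory.Sieve.SmoothCubeWeights
import HarnessLib

/-!
# A smooth partition of `[1, ∞)` into bumps supported in windows `[M, 2M]` (ratio `√2` scales)

Topic `Literature/NumberTheory/Sieve` (source-independent analytic tool).  Deshouillers–Iwaniec-type
bounds for sums of Kloosterman sums (Drappeau 2017, Prop. 4.13; Deshouillers–Iwaniec 1982, Thms
10–11) are stated for weights supported in a window `M ≤ m ≤ 2M` of ratio exactly `2`; to apply them
to all frequencies `h ≥ 1` produced by Poisson summation (Drappeau 2017, §4.3.3) one needs a SMOOTH
partition of unity whose pieces have such supports, with derivative bounds `≪_k M^{-k}` uniform in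
the piece.  Consecutive dyadic windows `[2^j, 2^{j+1}]` only touch, so the scales must grow slower
than `2`; this file uses the scales `a_j = (√2)^j`:

* `sqrtTwoScale j = (√2)^j` (`j ∈ ℤ`), `sqrtTwoStep j x = ψ((x/a_j − 1)/(√2 − 1))`
  (`ψ = Real.smoothTransition`): smooth, `= 0` for `x ≤ a_j`, `= 1` for `x ≥ a_{j+1}`, values in `[0,1]`;
* `sqrtTwoBump j = sqrtTwoStep j − sqrtTwoStep (j+1)`: smooth, values in `[0, 1]`, vanishing unless
  `a_j < x < 2a_j` (note `a_{j+2} = 2a_j`);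
* `sum_Icc_sqrtTwoBump`: `∑_{J₀ ≤ j ≤ J₁} φ_j = θ_{J₀} − θ_{J₁+1}` (telescoping), hence `= 1 − θ_{J₁+1}`
  on `[1, ∞)` when `J₀ = −1` (`sum_Icc_sqrtTwoBump_eq_one_sub`);
* `norm_iteratedDeriv_sqrtTwoStep_le`, `norm_iteratedDeriv_sqrtTwoBump_le`: `|φ_j^{(k)}| ≤ 2·stC k·(√2−1)^{-k}·a_j^{-k}`
  (`stC` the absolute bounds for `ψ^{(k)}` of `SmoothCubeWeights.lean`).

Everything PROVED; three definitions with bodies, no named fact.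

## References

* S. Drappeau, Proc. LMS (3) 114 (2017), §4.3.3 (dyadic decomposition in `m`).
  [cite: Drappeau2017, §4.3.3]
* [folklore] smooth partitions of unity by telescoping transitions.
-/

noncomputable section

open Real Set Finset
open scoped ContDiff Topology

namespace Literature.NumberTheory.Sieve

namespace KloostermanQuintilinear

open Literature.NumberTheory.Sieve.SmoothWeights (stC stC_nonneg
  norm_iteratedDeriv_smoothTransition_affine_le)

/-! ### Scales -/

/-- The scale `a_j = (√2)^j`, `j ∈ ℤ`. [folklore] -/
def sqrtTwoScale (j : ℤ) : ℝ := Real.sqrt 2 ^ j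

/-- `√2 − 1 > 0`. [folklore] -/
theorem sqrt_two_sub_one_pos : (0 : ℝ) < Real.sqrt 2 - 1 := sub_pos.mpr Real.one_lt_sqrt_two

/-- `a_j > 0`. [folklore] -/
theorem sqrtTwoScale_pos (j : ℤ) : 0 < sqrtTwoScale j :=
  zpow_pos (Real.sqrt_pos.mpr two_pos) j

/-- `a_{j+1} = √2 · a_j`. [folklore] -/
theorem sqrtTwoScale_succ (j : ℤ) : sqrtTwoScale (j + 1) = Real.sqrt 2 * sqrtTwoScale j := by
  unfold sqrtTwoScale
  rw [zpow_add_one₀ (Real.sqrt_pos.mpr two_pos).ne', mul_comm]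

/-- `a_{j+2} = 2 a_j`. [folklore] -/
theorem sqrtTwoScale_add_two (j : ℤ) : sqrtTwoScale (j + 2) = 2 * sqrtTwoScale j := by
  rw [show j + 2 = j + 1 + 1 by ring, sqrtTwoScale_succ, sqrtTwoScale_succ, ← mul_assoc,
    Real.mul_self_sqrt zero_le_two]

/-- `a_0 = 1`. [folklore] -/
@[simp] theorem sqrtTwoScale_zero : sqrtTwoScale 0 = 1 := by simp [sqrtTwoScale]

/-- `a_j ≤ a_{j+1}`. [folklore] -/
theorem sqrtTwoScale_le_succ (j : ℤ) : sqrtTwoScale j ≤ sqrtTwoScale (j + 1) := by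
  rw [sqrtTwoScale_succ]
  exact le_mul_of_one_le_left (sqrtTwoScale_pos j).le Real.one_lt_sqrt_two.le

/-- `a` is monotone. [folklore] -/
theorem sqrtTwoScale_mono : Monotone sqrtTwoScale := fun _ _ h =>
  zpow_le_zpow_right₀ Real.one_lt_sqrt_two.le h

/-- `a_{-1} = 1/√2 ≥ 1/2`. [folklore] -/
theorem half_le_sqrtTwoScale_neg_one : (1 / 2 : ℝ) ≤ sqrtTwoScale (-1) := by
  have h : sqrtTwoScale (-1 + 2) = 2 * sqrtTwoScale (-1) := sqrtTwoScale_add_two (-1)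
  rw [show (-1 : ℤ) + 2 = 1 by norm_num] at h
  have h1 : sqrtTwoScale 1 = Real.sqrt 2 := by simp [sqrtTwoScale]
  rw [h1] at h
  nlinarith [Real.one_lt_sqrt_two]

/-! ### The steps `θ_j` -/

/-- The smooth step `θ_j(x) = ψ((x/a_j − 1)/(√2 − 1))`: `0` for `x ≤ a_j`, `1` for `x ≥ a_{j+1}`.
[folklore] -/
def sqrtTwoStep (j : ℤ) (x : ℝ) : ℝ :=
  Real.smoothTransition ((x / sqrtTwoScale j - 1) / (Real.sqrt 2 - 1))

/-- `θ_j` as an affine reparametrisation of `ψ`. [folklore] -/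
theorem sqrtTwoStep_eq_affine (j : ℤ) :
    sqrtTwoStep j = fun x => Real.smoothTransition
      ((sqrtTwoScale j * (Real.sqrt 2 - 1))⁻¹ * x + (-(Real.sqrt 2 - 1)⁻¹)) := by
  funext x
  unfold sqrtTwoStep
  congr 1
  have h1 := (sqrtTwoScale_pos j).ne'
  have h2 := sqrt_two_sub_one_pos.ne'
  field_simp
  ring

/-- `θ_j(x) = 0` for `x ≤ a_j`. [folklore] -/
theorem sqrtTwoStep_of_le {j : ℤ} {x : ℝ} (hx : x ≤ sqrtTwoScale j) : sqrtTwoStep j x = 0 := by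
  unfold sqrtTwoStep
  apply Real.smoothTransition.zero_of_nonpos
  apply div_nonpos_of_nonpos_of_nonneg _ sqrt_two_sub_one_pos.le
  rw [sub_nonpos, div_le_one (sqrtTwoScale_pos j)]
  exact hx

/-- `θ_j(x) = 1` for `x ≥ a_{j+1}`. [folklore] -/
theorem sqrtTwoStep_of_ge {j : ℤ} {x : ℝ} (hx : sqrtTwoScale (j + 1) ≤ x) : sqrtTwoStep j x = 1 := by
  unfold sqrtTwoStep
  apply Real.smoothTransition.one_of_one_le
  rw [le_div_iff₀ sqrt_two_sub_one_pos, one_mul, le_sub_iff_add_le, sub_add_cancel,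
    le_div_iff₀ (sqrtTwoScale_pos j)]
  rw [sqrtTwoScale_succ] at hx
  exact hx

/-- `0 ≤ θ_j ≤ 1`. [folklore] -/
theorem sqrtTwoStep_mem_Icc (j : ℤ) (x : ℝ) : sqrtTwoStep j x ∈ Set.Icc (0 : ℝ) 1 :=
  ⟨Real.smoothTransition.nonneg _, Real.smoothTransition.le_one _⟩

/-- `θ_j` is smooth. [folklore] -/
theorem contDiff_sqrtTwoStep (j : ℤ) {n : ℕ∞} : ContDiff ℝ n (sqrtTwoStep j) := by
  rw [sqrtTwoStep_eq_affine]
  exact Real.smoothTransition.contDiff.comp ((contDiff_const.mul contDiff_id).add contDiff_const)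

/-- **`|θ_j^{(k)}| ≤ stC k · (√2−1)^{-k} · a_j^{-k}`**. [folklore] -/
theorem norm_iteratedDeriv_sqrtTwoStep_le (j : ℤ) (k : ℕ) (x : ℝ) :
    ‖iteratedDeriv k (sqrtTwoStep j) x‖ ≤
      stC k * ((Real.sqrt 2 - 1)⁻¹) ^ k * ((sqrtTwoScale j)⁻¹) ^ k := by
  rw [sqrtTwoStep_eq_affine]
  refine (norm_iteratedDeriv_smoothTransition_affine_le k _ _ x).trans (le_of_eq ?_)
  rw [abs_of_pos (by
    have := sqrtTwoScale_pos j; have := sqrt_two_sub_one_pos; positivity), mul_inv, mul_pow]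
  ring

/-! ### The bumps `φ_j` -/

/-- The bump `φ_j = θ_j − θ_{j+1}`, supported in `[a_j, 2a_j]`. [folklore] -/
def sqrtTwoBump (j : ℤ) (x : ℝ) : ℝ := sqrtTwoStep j x - sqrtTwoStep (j + 1) x

/-- Unfolding. [folklore] -/
theorem sqrtTwoBump_def (j : ℤ) (x : ℝ) :
    sqrtTwoBump j x = sqrtTwoStep j x - sqrtTwoStep (j + 1) x := rfl

/-- `φ_j(x) = 0` for `x ≤ a_j`. [folklore] -/
theorem sqrtTwoBump_of_le {j : ℤ} {x : ℝ} (hx : x ≤ sqrtTwoScale j) : sqrtTwoBump j x = 0 := by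
  rw [sqrtTwoBump_def, sqrtTwoStep_of_le hx,
    sqrtTwoStep_of_le (hx.trans (sqrtTwoScale_le_succ j)), sub_zero]

/-- `φ_j(x) = 0` for `x ≥ 2a_j`. [folklore] -/
theorem sqrtTwoBump_of_ge {j : ℤ} {x : ℝ} (hx : 2 * sqrtTwoScale j ≤ x) : sqrtTwoBump j x = 0 := by
  rw [← sqrtTwoScale_add_two] at hx
  rw [sqrtTwoBump_def, sqrtTwoStep_of_ge ((sqrtTwoScale_le_succ (j + 1)).trans (by
      rw [show j + 1 + 1 = j + 2 by ring]; exact hx)),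
    sqrtTwoStep_of_ge (by rw [show j + 1 + 1 = j + 2 by ring]; exact hx), sub_self]

/-- `φ_j(x) ≠ 0 ⟹ a_j < x < 2a_j`. [folklore] -/
theorem sqrtTwoBump_ne_zero {j : ℤ} {x : ℝ} (hx : sqrtTwoBump j x ≠ 0) :
    sqrtTwoScale j < x ∧ x < 2 * sqrtTwoScale j := by
  constructor
  · by_contra h
    exact hx (sqrtTwoBump_of_le (not_lt.mp h))
  · by_contra h
    exact hx (sqrtTwoBump_of_ge (not_lt.mp h))

/-- `|φ_j| ≤ 1`. [folklore] -/
theorem abs_sqrtTwoBump_le_one (j : ℤ) (x : ℝ) : |sqrtTwoBump j x| ≤ 1 := by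
  rw [sqrtTwoBump_def, abs_sub_le_iff]
  have h1 := sqrtTwoStep_mem_Icc j x
  have h2 := sqrtTwoStep_mem_Icc (j + 1) x
  constructor <;> linarith [h1.1, h1.2, h2.1, h2.2]

/-- `φ_j` is smooth. [folklore] -/
theorem contDiff_sqrtTwoBump (j : ℤ) {n : ℕ∞} : ContDiff ℝ n (sqrtTwoBump j) :=
  (contDiff_sqrtTwoStep j).sub (contDiff_sqrtTwoStep (j + 1))

/-- **`|φ_j^{(k)}| ≤ 2 · stC k · (√2−1)^{-k} · a_j^{-k}`**, uniformly in `j`. [folklore] -/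
theorem norm_iteratedDeriv_sqrtTwoBump_le (j : ℤ) (k : ℕ) (x : ℝ) :
    ‖iteratedDeriv k (sqrtTwoBump j) x‖ ≤
      2 * (stC k * ((Real.sqrt 2 - 1)⁻¹) ^ k * ((sqrtTwoScale j)⁻¹) ^ k) := by
  have hf : sqrtTwoBump j = fun x => sqrtTwoStep j x - sqrtTwoStep (j + 1) x := rfl
  have h1 : ContDiff ℝ k (sqrtTwoStep j) := contDiff_sqrtTwoStep j
  have h2 : ContDiff ℝ k (sqrtTwoStep (j + 1)) := contDiff_sqrtTwoStep (j + 1)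
  rw [hf, iteratedDeriv_fun_sub h1.contDiffAt h2.contDiffAt]
  refine (norm_sub_le _ _).trans ?_
  have b1 := norm_iteratedDeriv_sqrtTwoStep_le j k x
  have b2 := norm_iteratedDeriv_sqrtTwoStep_le (j + 1) k x
  -- the bound at scale `a_{j+1} ≥ a_j` is smaller
  have hmono : ((sqrtTwoScale (j + 1))⁻¹) ^ k ≤ ((sqrtTwoScale j)⁻¹) ^ k := by
    refine pow_le_pow_left₀ (inv_nonneg.mpr (sqrtTwoScale_pos _).le) ?_ k
    exact inv_anti₀ (sqrtTwoScale_pos j) (sqrtTwoScale_le_succ j)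
  have hc : 0 ≤ stC k * ((Real.sqrt 2 - 1)⁻¹) ^ k :=
    mul_nonneg (stC_nonneg k) (pow_nonneg (inv_nonneg.mpr sqrt_two_sub_one_pos.le) k)
  have b2' : ‖iteratedDeriv k (sqrtTwoStep (j + 1)) x‖ ≤
      stC k * ((Real.sqrt 2 - 1)⁻¹) ^ k * ((sqrtTwoScale j)⁻¹) ^ k :=
    b2.trans (mul_le_mul_of_nonneg_left hmono hc)
  linarith

/-! ### Telescoping -/

/-- **Telescoping**: `∑_{J₀ ≤ j ≤ J₁} φ_j(x) = θ_{J₀}(x) − θ_{J₁+1}(x)`. [folklore] -/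
theorem sum_Icc_sqrtTwoBump {J₀ J₁ : ℤ} (h : J₀ ≤ J₁) (x : ℝ) :
    ∑ j ∈ Finset.Icc J₀ J₁, sqrtTwoBump j x = sqrtTwoStep J₀ x - sqrtTwoStep (J₁ + 1) x := by
  obtain ⟨n, rfl⟩ : ∃ n : ℕ, J₁ = J₀ + n :=
    ⟨(J₁ - J₀).toNat, by rw [Int.toNat_of_nonneg (by linarith)]; ring⟩
  clear h
  induction n with
  | zero =>
    simp [sqrtTwoBump_def]
  | succ n ih =>
    rw [show J₀ + ((n + 1 : ℕ) : ℤ) = J₀ + (n : ℕ) + 1 by push_cast; ring,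
      ← Finset.insert_Icc_right_eq_Icc_add_one (by linarith), Finset.sum_insert (by simp), ih,
      sqrtTwoBump_def]
    ring

/-- **Partition of `[1, ∞)`**: for `x ≥ 1` and `J ≥ -1`,
`∑_{-1 ≤ j ≤ J} φ_j(x) = 1 − θ_{J+1}(x)`. [folklore] -/
theorem sum_Icc_sqrtTwoBump_eq_one_sub {J : ℤ} (hJ : -1 ≤ J) {x : ℝ} (hx : 1 ≤ x) :
    ∑ j ∈ Finset.Icc (-1) J, sqrtTwoBump j x = 1 - sqrtTwoStep (J + 1) x := by
  rw [sum_Icc_sqrtTwoBump hJ, sqrtTwoStep_of_ge]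
  rw [show (-1 : ℤ) + 1 = 0 by norm_num, sqrtTwoScale_zero]
  exact hx

/-- The top step vanishes below its scale: `θ_{J+1}(x) = 0` for `x ≤ a_{J+1}`. [folklore] -/
theorem sqrtTwoStep_top_of_le {J : ℤ} {x : ℝ} (hx : x ≤ sqrtTwoScale (J + 1)) :
    sqrtTwoStep (J + 1) x = 0 :=
  sqrtTwoStep_of_le hx

/-- **Choice of the top index**: for `H ≥ 1` there is `J ≥ -1` with `a_J < H ≤ a_{J+1}` and
`J + 2 ≤ 2 log H / log √2 + 2` (the number of pieces `-1 ≤ j ≤ J` is logarithmic in `H`). [folklore] -/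
theorem exists_top_index {H : ℝ} (hH : 1 ≤ H) :
    ∃ J : ℤ, -1 ≤ J ∧ H ≤ sqrtTwoScale (J + 1) ∧ sqrtTwoScale J < H ∧
      (J + 2 : ℝ) ≤ 2 * Real.log H / Real.log (Real.sqrt 2) + 2 := by
  -- `J + 1 = ⌈log H / log √2⌉`
  have hlog2 : 0 < Real.log (Real.sqrt 2) := Real.log_pos Real.one_lt_sqrt_two
  have hlogH : 0 ≤ Real.log H := Real.log_nonneg hH
  set m : ℤ := ⌈Real.log H / Real.log (Real.sqrt 2)⌉ with hm
  have hm0 : 0 ≤ m := Int.ceil_nonneg (div_nonneg hlogH hlog2.le)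
  refine ⟨m - 1, by linarith, ?_, ?_, ?_⟩
  · -- `H ≤ √2^m`
    rw [sub_add_cancel]
    unfold sqrtTwoScale
    have h1 : Real.log H / Real.log (Real.sqrt 2) ≤ m := Int.le_ceil _
    have h2 : Real.log H ≤ m * Real.log (Real.sqrt 2) := by
      rwa [div_le_iff₀ hlog2] at h1
    have h3 : Real.log H ≤ Real.log (Real.sqrt 2 ^ m) := by
      rw [Real.log_zpow]; exact h2
    exact (Real.log_le_log_iff (by linarith) (zpow_pos (Real.sqrt_pos.mpr two_pos) _)).mp h3
  · -- `√2^{m-1} < H`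
    unfold sqrtTwoScale
    have h1 : ((m - 1 : ℤ) : ℝ) < Real.log H / Real.log (Real.sqrt 2) := by
      have := Int.ceil_lt_add_one (Real.log H / Real.log (Real.sqrt 2))
      push_cast
      linarith
    have h2 : ((m - 1 : ℤ) : ℝ) * Real.log (Real.sqrt 2) < Real.log H := by
      rwa [lt_div_iff₀ hlog2] at h1
    have h3 : Real.log (Real.sqrt 2 ^ (m - 1)) < Real.log H := by
      rw [Real.log_zpow]; exact h2
    exact (Real.log_lt_log_iff (zpow_pos (Real.sqrt_pos.mpr two_pos) _) (by linarith)).mp h3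
  · have := Int.ceil_lt_add_one (Real.log H / Real.log (Real.sqrt 2))
    have h4 : (m : ℝ) < Real.log H / Real.log (Real.sqrt 2) + 1 := this
    push_cast
    have : Real.log H / Real.log (Real.sqrt 2) ≤ 2 * Real.log H / Real.log (Real.sqrt 2) := by
      rw [div_le_div_iff_of_pos_right hlog2]; linarith
    linarith

end KloostermanQuintilinear

end Literature.NumberTheory.Sieve

end
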